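import Summits.BirchSwinnertonDyer.Rank1Residual.X10.GreenbergMuBridgeData
import Summits.BirchSwinnertonDyer.Rank1Residual.X9.TwistStability
import HarnessLib

/-!
# Class X10b (`p = 3`, `E[3]` irreducible, `ρ̄_{E,3}` NOT surjective): the print road of
# `X10/GreenbergMuBridge` from the CLASS-RESTRICTED algebraic `μ = 0` — «μ(X(V/ℚ_∞)) = 0 for every
# globally minimal `V/ℚ` good ordinary at `3` with `E[3]` irreducible and `ρ̄_{V,3}` not surjective»
# (the twist-closed small-image class at `3`) — instead of Greenberg's conjecture for all curves

Cell `bsd-print-x9` (D-0131 (2) PRINT tier), seat `bsd-print-x9-p1` (prover p1), generation 2. Companion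
of `X10/GreenbergMuBridge.lean` (p540919) and `X10/GreenbergMuBridgeData.lean` (p545070, same seat).

HONEST FRAMING. BSD is not proved here and no class is closed. The two sibling files give the cell's
SECOND leaf `X10.BSDpOnClassX10b` from Greenberg's Conjecture 1.11 in its irreducible form
(`Rank1Residual.GreenbergMuConjectureIrreducible`: `μ = 0` for EVERY elliptic `W/ℚ`, every prime `p` with
`E[p]` irreducible) + named facts + C3. The proof USES the conjecture only at `p = 3` and only at two
curves per pair: the X10b curve `W` itself and a globally minimal model `W'` of its twist `E^K = E^{(d_K)}`
by the auxiliary Heegner field `K` (`3` split, so `3 ∤ d_K`): `W'` is again good ordinary at `3`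
(`isOrdinaryAt_of_smul_eq_quadraticTwist_discr`), `E^K[3] ≅ E[3] ⊗ χ` is irreducible
(`irr_of_smul_eq_quadraticTwist`) and `ρ̄_{E^K,3}` is not surjective (`X9.surj_iff_of_smul_eq_quadraticTwist`:
a quadratic twist does not change the projective image). So the honest residual crux of this road is the
CLASS-RESTRICTED statement

  (μ3)  for every globally minimal `V/ℚ` with good ordinary reduction at `3`, `E[3]` irreducible and
        `ρ̄_{V,3}` NOT surjective, every cyclotomic datum `(κ, γ)` over `ℚ` and every dual Selmer datum
        `D` of `V` over `ℚ_∞` which is `Λ`-torsion: `μ(D) = 0`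

— Greenberg's Conjecture 1.11 on the twist-closed envelope of the X10b class (no analytic-rank clause; the
torsion guard is discharged inside by the rational main conjecture, Yan–Zhu Thm. 4.9). This file proves
the road from (μ3), spelled INLINE as a hypothesis `hμ3` (no new definition; the planner may file it as an
item statement verbatim):

* `mu_eq_zero_of_smul_eq_of_forall` — `μ` of a dual Selmer datum is invariant along an equation of models
  `C • W₁ = W₂` (`IsogenySelmerInfty.selmerDualDataOfSmul`: same `Λ`-module), so a torsion-guarded
  `μ = 0` for all data of `W₁` gives it for all data of `W₂`.
* `mazurMainConjecture_three_of_mu_eq_zero_of_minimalTwists` — PER PAIR: the sibling's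
  `mazurMainConjecture_three_of_mu_eq_zero` with the twist hypothesis weakened from «all twists `W^{(d)}`,
  `d ≠ 0`» to «every globally minimal model of a twist which is good ordinary at `3`» (the only twist
  used is `E^K`).
* `mazurMainConjecture_three_of_muZeroSmallImageThree` — (μ3) + named facts ⟹ `MazurMainConjecture W 3`
  at EVERY globally minimal small-image good-ordinary irreducible pair, ANY analytic rank;
  `mazurMainConjectureOnClassX10b_of_muZeroSmallImageThree` — its class reading X_A3;
  `bsdpOnClassX10b_of_muZeroSmallImageThree` — ⟹ the leaf (+ the odd-prime BSD binders + C3);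
  `analyticMuZeroOnClassX10b_of_muZeroSmallImageThree` — ⟹ the K6-at-3 analytic crux;
  `muZeroSmallImageThree_of_greenbergMuConjectureIrreducible` — (μ3) ⟸ Greenberg, and the composite
  `mazurMainConjecture_three_of_greenbergMuConjectureIrreducible` (rank-free per-pair X_A3 from Greenberg;
  the sibling's class displays are its restrictions).

NET (numbers): the X10b print road's ONE residual crux is (μ3) — strictly weaker than
`GreenbergMuConjectureIrreducible` (one prime, one twist-closed class); named facts as in the siblings
(11 for X_A3; flag `YZ26@3-BF-ERL-Ohta` travels); beyond-print theorem: no; nothing booked.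

References: [GreenbergLNM1716] §1 Conj. 1.11; [YanZhu2024MainConjNonCM] Thm. 4.9 (v2) = Thm. 5.2 (v4) and
its proof, Thm. 4.2 (1), Lemma 5.3, Prop. 3.7; [MatarNekovar2019] Prop. 5.26 (2), (3); [SilvermanAEC2009]
X.5 Cor. 5.4 (twists); [Serre1972] §2 (images under twist).
-/

set_option autoImplicit false

noncomputable section

open scoped Classical MatrixGroups ModularForm

open CongruenceSubgroup WeierstrassCurve Field NumberField IsDedekindDomain
open Literature.NumberTheory.GaloisRepresentations
open Literature.NumberTheory.EllipticCurves Literature.NumberTheory.EllipticCurves.ModularForms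
  Literature.NumberTheory.EllipticCurves.Rank1Residual
  Summit.BirchSwinnertonDyer.BirchSwinnertonDyer.Theorems.Rank1ResidualX1Defs
open Literature.NumberTheory.EllipticCurves.YanZhu2026

namespace Summit.BirchSwinnertonDyer.Rank1Residual.X10

/-! ### §1 `μ` along an equation of models -/

/-- **`μ = 0` transports along an equation of Weierstrass models.** If `C • W₁ = W₂` over `ℚ` and every
`Λ`-torsion dual Selmer datum of `W₁` over the `ℤ_p`-extension `κ` has `μ = 0`, then so does every
`Λ`-torsion dual Selmer datum of `W₂`: the transported datum `IsogenySelmerInfty.selmerDualDataOfSmul` has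
the SAME underlying `Λ`-module (`mu_selmerDualDataOfSmul`, `isTorsion_selmerDualDataOfSmul_iff`, both
`rfl`). [cite: GreenbergLNM1716, §1 (the Λ-module X(E/F_∞) is attached to E/F, not to a model)] -/
theorem mu_eq_zero_of_smul_eq_of_forall {W₁ W₂ : WeierstrassCurve ℚ} [W₁.IsElliptic] [W₂.IsElliptic]
    {C : VariableChange ℚ} (h : C • W₁ = W₂) {p : ℕ} [Fact p.Prime] {κ : ZpExtension ℚ p}
    {γ : Field.absoluteGaloisGroup ℚ} (D₂ : W₂.SelmerDualData κ γ)
    (hμ : ∀ D₁ : W₁.SelmerDualData κ γ, D₁.IsTorsion → D₁.mu = 0) (ht : D₂.IsTorsion) : D₂.mu = 0 := by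
  subst h
  exact hμ (IsogenySelmerInfty.selmerDualDataOfSmul W₁ p C D₂) ht

/-! ### §2 Per pair: the twist hypothesis only at globally minimal good-ordinary models of twists -/

/-- **Per pair, twist hypothesis restricted to minimal good-ordinary models.** For `W` globally minimal,
good ordinary at `3` with `E[3]` irreducible, granted the named facts of the siblings (`h42`, `h49`, `h53`,
`h37`, `hmod`, `hmodP`, `h3`, `h526`, `h526c`): if at every cyclotomic datum `(κ, γ)` (i) `μ(D) = 0` for
every dual Selmer datum `D` of `W` and (ii) `μ(D') = 0` for every `Λ`-TORSION dual Selmer datum `D'` of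
every GLOBALLY MINIMAL model `W'` of a quadratic twist `W^{(d)}` (`C • W' = W.quadraticTwist d`, `d ≠ 0`)
which is GOOD ORDINARY at `3`, then `MazurMainConjecture W 3`. Same proof as the gen-0 per-pair theorem
(Yan–Zhu's two-variable argument at the data of `exists_twoVariableData_three`; the twist `E^K` on a
globally minimal model `W'`, good ordinary at `3` since `3 ∤ d_K`), with `μ(D') = 0` for the datum of
`W.quadraticTwist d_K` obtained from (ii) at `W'` by `mu_eq_zero_of_smul_eq_of_forall` (torsion from the
rational clause `h49` at `W'`). CONDITIONAL on (i)/(ii).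
[cite: YanZhu2024MainConjNonCM, Thm. 4.9 (v2) = Thm. 5.2 (v4) and its proof; Thm. 4.2 (1); Lemma 5.3; Prop. 3.7]
[cite: GreenbergVatsal2000, Prop. 3.7 and §3 Remark (3.4)] [cite: GreenbergLNM1716, §1 Conj. 1.11] -/
theorem mazurMainConjecture_three_of_mu_eq_zero_of_minimalTwists
    (h42 : thm42_XOrd₂_isTorsion_charIdeal_le_perrinRiou)
    (h49 : thm49_charIdeal_eq_padicLFunction)
    (h53 : lemma53_charIdeal_mul_charIdeal_le_toPlus_charIdeal)
    (h37 : prop37_cycRestrict_perrinRiou_eq_padicLFunction_mul)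
    (hmod : exists_isNewformOf) (hmodP : nonempty_modularParametrizationData)
    (h3 : realPeriodRat_eq_unit_mul_plusPeriod_three)
    (h526 : MatarNekovar2019.prop526_hasIrreducibleModPGaloisRep_baseChange)
    (h526c : MatarNekovar2019.prop526_three_of_irreducible_of_not_isAbsolutelyIrreducible)
    (W : WeierstrassCurve ℚ) [W.IsElliptic] [W.IsGloballyMinimal] [Fact (Nat.Prime 3)]
    (hgood : W.HasGoodReductionAtPrime 3) (hord : ¬ ((3 : ℕ) : ℤ) ∣ W.frobeniusTrace 3)
    (hirr : W.HasIrreducibleModPGaloisRep 3)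
    (hμ : ∀ (κ : ZpExtension ℚ 3) (γ : Field.absoluteGaloisGroup ℚ),
      κ.IsCyclotomic → κ.IsTopGenerator γ → IsCyclotomicVariable 3 γ →
      (∀ D : W.SelmerDualData κ γ, D.mu = 0) ∧
      ∀ (W' : WeierstrassCurve ℚ) [W'.IsElliptic] [W'.IsGloballyMinimal] (d : ℚ) (C : VariableChange ℚ),
        d ≠ 0 → C • W' = W.quadraticTwist d →
        W'.HasGoodReductionAtPrime 3 → ¬ ((3 : ℕ) : ℤ) ∣ W'.frobeniusTrace 3 →
        ∀ D' : W'.SelmerDualData κ γ, D'.IsTorsion → D'.mu = 0) :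
    MazurMainConjecture W 3 := by
  intro κ γ hκ hγ hγ' _ f hf ϖ hϖeq D
  obtain ⟨hμW, hμtw⟩ := hμ κ γ hκ hγ hγ'
  obtain ⟨ι, K, _instF, _instNF, κ₁, κ₂, γ₁, γ₂, hpair, hK, hsplit, hHeeg, hN, hirrK, habs, hκ₁, hκ₂,
    hγ₁, hγ₁'⟩ := exists_twoVariableData_three h526 h526c W hirr κ γ hκ hγ hγ'
  haveI : Fact (ZpExtension.IsTopGeneratorPair κ₁ κ₂ γ₁ γ₂) := ⟨hpair⟩
  have hordW : GoodOrd W 3 := ⟨hgood, hord⟩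
  -- the modular parametrisation at level `N_E`; its newform is `f`
  obtain ⟨π⟩ := hmodP W
  have hfπ : f = π.f := hf.unique π.isNewformOf
  subst hfπ
  -- Thm. 4.2 (1): the type-I frame `F` and the divisibility (DIV)
  obtain ⟨F, hF, -, -, hdiv, -⟩ := h42 ι W K κ₁ κ₂ γ₁ γ₂ π le_rfl hordW hK hsplit hHeeg habs
  -- a globally minimal model of `E^K = E^{(d_K)}`: good ordinary at `3`, irreducible, its newform, `ϖ'`
  have hd : (NumberField.discr K : ℚ) ≠ 0 := by exact_mod_cast NumberField.discr_ne_zero K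
  obtain ⟨W', hE', hM', C, hC⟩ := exists_isGloballyMinimal_smul_eq_quadraticTwist W hd
  have hpd : ¬ ((3 : ℕ) : ℤ) ∣ NumberField.discr K :=
    not_dvd_discr_of_ncard_primesOver_eq_two hK.finrank_eq_two (Fact.out : Nat.Prime 3) hsplit
  have hord' : GoodOrd W' 3 :=
    isOrdinaryAt_of_smul_eq_quadraticTwist_discr hK.finrank_eq_two W W' hC 3 (by norm_num) hpd hordW
  have hirr' : Irr W' 3 := irr_of_smul_eq_quadraticTwist W W' hd hC hirr
  haveI : NeZero (W'.conductorNorm ℤ) := ⟨(W'.conductorNorm_pos_holds).ne'⟩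
  obtain ⟨g, hg⟩ := hmod W'
  obtain ⟨u', hu'1, hu'Ω⟩ := h3 W' hord'.1 hirr' g hg
  have hu'0 : (u' : ℝ) ≠ 0 := by
    have : (u' : ℚ_[3]) ≠ 0 := fun h0 => by rw [h0, norm_zero] at hu'1; exact zero_ne_one hu'1
    exact_mod_cast (show u' ≠ 0 from fun h0 => this (by rw [h0]; push_cast; rfl))
  have hϖ' : ((u'⁻¹ : ℚ) : ℝ) * W'.realPeriodRat = plusPeriod g := by
    rw [hu'Ω, Rat.cast_inv, ← mul_assoc, inv_mul_cancel₀ hu'0, one_mul]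
  have hϖu' : ‖((u'⁻¹ : ℚ) : ℚ_[3])‖ = 1 := by rw [Rat.cast_inv, norm_inv, hu'1, inv_one]
  have hϖu : ‖(ϖ : ℚ_[3])‖ = 1 :=
    UnitRoad.norm_periodRatio_eq_one_three h3 W hgood hirr π.f π.isNewformOf ϖ hϖeq
  -- the dual datum of the twisted model and its `μ = 0`, transported from the minimal model `W'`
  haveI := W.isElliptic_quadraticTwist hd
  set D' : (W.quadraticTwist (NumberField.discr K : ℚ)).SelmerDualData κ γ :=
    (W.quadraticTwist (NumberField.discr K : ℚ)).selmerDualData κ hγ with hD'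
  obtain ⟨D'', hchar'', htors''⟩ :=
    Literature.NumberTheory.EllipticCurves.IsogenySelmerInfty.exists_selmerDualData_of_smul_eq 3 hC D'
  have ht' : D'.IsTorsion :=
    htors''.mp (h49 W' 3 κ γ g le_rfl hord'.1 hord'.2 hirr' hκ hγ hγ' hg D'').1
  have hμD' : D'.mu = 0 :=
    mu_eq_zero_of_smul_eq_of_forall hC D'
      (fun D₁ hD₁ => hμtw W' (NumberField.discr K : ℚ) C hd hC hord'.1 hord'.2 D₁ hD₁) ht'
  -- the two-variable argument: `Char X(W/ℚ_∞) = (g₀)`, `ι g₀ = L_3(π.f, α)`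
  obtain ⟨htors, g₀, hchar, hιg⟩ :=
    charIdeal_eq_padicLFunction_of_mu_eq_zero_of_facts h49 h53 h37 ι W K κ₁ κ₂ γ₁ γ₂ π κ γ D D' ϖ W'
      g u'⁻¹ rfl le_rfl hordW hirr hK hsplit hN hirrK hκ₁ hκ₂ hκ hγ hγ' hγ₁ hγ₁' hϖeq hϖu ⟨C, hC⟩ hg
      hϖ' hϖu' hord' hF hdiv (hμW D) hμD'
  -- Mazur's normalisation: multiply by the unit `ϖ`
  set c : ℤ_[3] := ⟨(ϖ : ℚ_[3]), hϖu.le⟩ with hc_def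
  have hcu : IsUnit c := PadicInt.isUnit_iff.mpr hϖu
  refine ⟨htors, PowerSeries.C c * g₀, ?_, ?_⟩
  · rw [hchar]
    exact (Ideal.span_singleton_mul_left_unit (hcu.map PowerSeries.C) g₀).symm
  · rw [map_mul, hιg, PowerSeries.map_C]
    rfl

/-! ### §3 Class level: the twist-closed small-image class at `3` -/

/-- **X_A3 PER PAIR, ANY ANALYTIC RANK, from the CLASS-RESTRICTED algebraic `μ = 0` (μ3) and named
facts.** Hypothesis `hμ3` (spelled inline; the residual crux of this road BY NAME once filed): for every
globally minimal `V/ℚ` good ordinary at `3` with `E[3]` irreducible and `ρ̄_{V,3}` NOT surjective, every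
cyclotomic datum and every `Λ`-torsion dual Selmer datum `D` of `V`, `μ(D) = 0`. Conclusion: Mazur's
integral main conjecture `MazurMainConjecture W 3` at EVERY such pair `(W, 3)` — no analytic-rank clause
(so also at the rank-`0` (ram) pairs and at rank `≥ 2`, outside `ClassX10`). The per-pair theorem of §2 is
fed with (μ3) at `W` (torsion guard from the rational clause `h49` at a newform of `hmod`) and at the
minimal good-ordinary models `W'` of its twists, which lie in the class: `E^{(d)}[3]` irreducible
(`irr_of_smul_eq_quadraticTwist`) and `ρ̄_{E^{(d)},3}` not surjective
(`X9.surj_iff_of_smul_eq_quadraticTwist`). No Kato package, no analytic certificate, no data binder.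
CONDITIONAL on (μ3); flag `YZ26@3-BF-ERL-Ohta` travels; nothing booked.
[cite: GreenbergLNM1716, §1 Conj. 1.11] [cite: YanZhu2024MainConjNonCM, Thm. 4.9 (v2) = Thm. 5.2 (v4)]
[cite: SilvermanAEC2009, X.5 Cor. 5.4] [cite: MatarNekovar2019, Prop. 5.26 (2), (3)] -/
theorem mazurMainConjecture_three_of_muZeroSmallImageThree
    (hμ3 : ∀ (V : WeierstrassCurve ℚ) [V.IsElliptic] [V.IsGloballyMinimal],
      V.HasGoodReductionAtPrime 3 → ¬ ((3 : ℕ) : ℤ) ∣ V.frobeniusTrace 3 →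
      V.HasIrreducibleModPGaloisRep 3 → ¬ V.HasSurjectiveModNGaloisRep 3 →
      ∀ (κ : ZpExtension ℚ 3) (γ : Field.absoluteGaloisGroup ℚ),
        κ.IsCyclotomic → κ.IsTopGenerator γ → IsCyclotomicVariable 3 γ →
        ∀ D : V.SelmerDualData κ γ, D.IsTorsion → D.mu = 0)
    (h42 : thm42_XOrd₂_isTorsion_charIdeal_le_perrinRiou)
    (h49 : thm49_charIdeal_eq_padicLFunction)
    (h53 : lemma53_charIdeal_mul_charIdeal_le_toPlus_charIdeal)
    (h37 : prop37_cycRestrict_perrinRiou_eq_padicLFunction_mul)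
    (hmod : exists_isNewformOf) (hmodP : nonempty_modularParametrizationData)
    (h3 : realPeriodRat_eq_unit_mul_plusPeriod_three)
    (h526 : MatarNekovar2019.prop526_hasIrreducibleModPGaloisRep_baseChange)
    (h526c : MatarNekovar2019.prop526_three_of_irreducible_of_not_isAbsolutelyIrreducible)
    (W : WeierstrassCurve ℚ) [W.IsElliptic] [W.IsGloballyMinimal] [Fact (Nat.Prime 3)]
    (hgood : W.HasGoodReductionAtPrime 3) (hord : ¬ ((3 : ℕ) : ℤ) ∣ W.frobeniusTrace 3)
    (hirr : W.HasIrreducibleModPGaloisRep 3) (hns : ¬ W.HasSurjectiveModNGaloisRep 3) :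
    MazurMainConjecture W 3 := by
  refine mazurMainConjecture_three_of_mu_eq_zero_of_minimalTwists h42 h49 h53 h37 hmod hmodP h3 h526
    h526c W hgood hord hirr ?_
  intro κ γ hκ hγ hγ'
  haveI : NeZero (W.conductorNorm ℤ) := ⟨(W.conductorNorm_pos_holds).ne'⟩
  obtain ⟨f₀, hf₀⟩ := hmod W
  refine ⟨fun D => hμ3 W hgood hord hirr hns κ γ hκ hγ hγ' D
    (h49 W 3 κ γ f₀ le_rfl hgood hord hirr hκ hγ hγ' hf₀ D).1, ?_⟩
  intro W' _ _ d C hd hC hgood' hord' D' hD'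
  have hirr' : Irr W' 3 := irr_of_smul_eq_quadraticTwist W W' hd hC hirr
  have hns' : ¬ Surj W' 3 := fun h => hns ((X9.surj_iff_of_smul_eq_quadraticTwist W W' 3 hd hC).mp h)
  exact hμ3 W' hgood' hord' hirr' hns' κ γ hκ hγ hγ' D' hD'

/-- **X_A3 = `MazurMainConjectureOnClassX10b` from (μ3) and named facts** — the class reading of
`mazurMainConjecture_three_of_muZeroSmallImageThree` (an X10b pair has `p = 3`, good ordinary, `E[3]`
irreducible, `ρ̄` not surjective). CONDITIONAL on (μ3); nothing booked.
[cite: GreenbergLNM1716, §1 Conj. 1.11] [cite: YanZhu2024MainConjNonCM, Thm. 4.9 (v2) = Thm. 5.2 (v4)] -/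
theorem mazurMainConjectureOnClassX10b_of_muZeroSmallImageThree
    (hμ3 : ∀ (V : WeierstrassCurve ℚ) [V.IsElliptic] [V.IsGloballyMinimal],
      V.HasGoodReductionAtPrime 3 → ¬ ((3 : ℕ) : ℤ) ∣ V.frobeniusTrace 3 →
      V.HasIrreducibleModPGaloisRep 3 → ¬ V.HasSurjectiveModNGaloisRep 3 →
      ∀ (κ : ZpExtension ℚ 3) (γ : Field.absoluteGaloisGroup ℚ),
        κ.IsCyclotomic → κ.IsTopGenerator γ → IsCyclotomicVariable 3 γ →
        ∀ D : V.SelmerDualData κ γ, D.IsTorsion → D.mu = 0)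
    (h42 : thm42_XOrd₂_isTorsion_charIdeal_le_perrinRiou)
    (h49 : thm49_charIdeal_eq_padicLFunction)
    (h53 : lemma53_charIdeal_mul_charIdeal_le_toPlus_charIdeal)
    (h37 : prop37_cycRestrict_perrinRiou_eq_padicLFunction_mul)
    (hmod : exists_isNewformOf) (hmodP : nonempty_modularParametrizationData)
    (h3 : realPeriodRat_eq_unit_mul_plusPeriod_three)
    (h526 : MatarNekovar2019.prop526_hasIrreducibleModPGaloisRep_baseChange)
    (h526c : MatarNekovar2019.prop526_three_of_irreducible_of_not_isAbsolutelyIrreducible) :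
    MazurMainConjectureOnClassX10b := by
  intro W _ _ p _ hX hns
  obtain ⟨hp3, hgo, hirr, -⟩ := id hX
  subst hp3
  obtain ⟨hgood, hord⟩ := hgo
  exact mazurMainConjecture_three_of_muZeroSmallImageThree hμ3 h42 h49 h53 h37 hmod hmodP h3 h526 h526c W
    hgood hord hirr hns

/-- **The X10b leaf from (μ3), named facts and C3.** `BSDpOnClassX10b` (both analytic ranks) through
`bsdpOnClassX10b_of_mazurMainConjectureOnClassX10b` (odd-prime binders `hS`, `hPR`, `hMT`, `hGr`, `hGZK`,
`hmodP`; `hC3` = Schneider's non-degeneracy on the rank-`1` X10b pairs) fed with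
`mazurMainConjectureOnClassX10b_of_muZeroSmallImageThree`. On this road the cell's SECOND LEAF has exactly
one non-print, non-certificate binder: (μ3). CONDITIONAL; nothing booked; beyond-print theorem: no.
[cite: GreenbergLNM1716, §1 Conj. 1.11 and Thm. 4.1] [cite: Miller2011LMS, §1 and Def. 1.1]
[cite: YanZhu2024MainConjNonCM, Thm. 4.9 (v2) = Thm. 5.2 (v4) and its proof] -/
theorem bsdpOnClassX10b_of_muZeroSmallImageThree
    (hμ3 : ∀ (V : WeierstrassCurve ℚ) [V.IsElliptic] [V.IsGloballyMinimal],
      V.HasGoodReductionAtPrime 3 → ¬ ((3 : ℕ) : ℤ) ∣ V.frobeniusTrace 3 →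
      V.HasIrreducibleModPGaloisRep 3 → ¬ V.HasSurjectiveModNGaloisRep 3 →
      ∀ (κ : ZpExtension ℚ 3) (γ : Field.absoluteGaloisGroup ℚ),
        κ.IsCyclotomic → κ.IsTopGenerator γ → IsCyclotomicVariable 3 γ →
        ∀ D : V.SelmerDualData κ γ, D.IsTorsion → D.mu = 0)
    (h42 : thm42_XOrd₂_isTorsion_charIdeal_le_perrinRiou)
    (h49 : thm49_charIdeal_eq_padicLFunction)
    (h53 : lemma53_charIdeal_mul_charIdeal_le_toPlus_charIdeal)
    (h37 : prop37_cycRestrict_perrinRiou_eq_padicLFunction_mul)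
    (hmod : exists_isNewformOf) (hmodP : nonempty_modularParametrizationData)
    (h3 : realPeriodRat_eq_unit_mul_plusPeriod_three)
    (h526 : MatarNekovar2019.prop526_hasIrreducibleModPGaloisRep_baseChange)
    (h526c : MatarNekovar2019.prop526_three_of_irreducible_of_not_isAbsolutelyIrreducible)
    (hS : Schneider1985_order_charGenerator_odd) (hPR : perrinRiou_rankOne_leadingTerms_odd)
    (hMT : mazur_tate_sigma_exists_odd) (hGr : greenberg_charValue_rankZero)
    (hGZK : rank_eq_analyticRank_of_analyticRank_le_one)
    (hC3 : ∀ (W : WeierstrassCurve ℚ) [W.IsElliptic] [W.IsGloballyMinimal] (p : ℕ) [Fact p.Prime],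
      ClassX10 W p → ¬ Surj W 3 → W.analyticRank = 1 →
        ∀ Dh : PAdicHeightData W p, Dh.IsCanonical → SchneiderConjecture Dh) :
    BSDpOnClassX10b :=
  bsdpOnClassX10b_of_mazurMainConjectureOnClassX10b hS hPR hMT hGr hmodP hGZK hC3
    (mazurMainConjectureOnClassX10b_of_muZeroSmallImageThree hμ3 h42 h49 h53 h37 hmod hmodP h3 h526 h526c)

/-- **The K6-at-3 analytic crux from (μ3), modulo print.** (μ3) + the named facts ⟹
`AnalyticMuZeroOnClassX10b`: at an X10b pair and a newform `f` of `W` (level `N_E`,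
`IsNewformOf.level_eq_conductorNorm_of_exists_isNewformOf`), X_A3 at the pair
(`mazurMainConjectureOnClassX10b_of_muZeroSmallImageThree`: `char X = (g)`, `ι g = ϖ·L_3(f,α)`, `ϖ` from
`h3`, `‖ϖ‖₃ = 1`) and `μ(X) = 0` ((μ3) at `W`) give `g ∉ 3Λ`, hence a `3`-adic unit coefficient of
`L_3(f,α)`. So on this road BOTH K6 cruxes at `3` (μ-transfer · analytic μ = 0) sit downstream of the
single algebraic statement (μ3). CONDITIONAL; nothing booked.
[cite: GreenbergLNM1716, §1 Conj. 1.11] [cite: GreenbergVatsal2000, Prop. 3.7 and §3 Remark (3.4)] -/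
theorem analyticMuZeroOnClassX10b_of_muZeroSmallImageThree
    (hμ3 : ∀ (V : WeierstrassCurve ℚ) [V.IsElliptic] [V.IsGloballyMinimal],
      V.HasGoodReductionAtPrime 3 → ¬ ((3 : ℕ) : ℤ) ∣ V.frobeniusTrace 3 →
      V.HasIrreducibleModPGaloisRep 3 → ¬ V.HasSurjectiveModNGaloisRep 3 →
      ∀ (κ : ZpExtension ℚ 3) (γ : Field.absoluteGaloisGroup ℚ),
        κ.IsCyclotomic → κ.IsTopGenerator γ → IsCyclotomicVariable 3 γ →
        ∀ D : V.SelmerDualData κ γ, D.IsTorsion → D.mu = 0)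
    (h42 : thm42_XOrd₂_isTorsion_charIdeal_le_perrinRiou)
    (h49 : thm49_charIdeal_eq_padicLFunction)
    (h53 : lemma53_charIdeal_mul_charIdeal_le_toPlus_charIdeal)
    (h37 : prop37_cycRestrict_perrinRiou_eq_padicLFunction_mul)
    (hmod : exists_isNewformOf) (hmodP : nonempty_modularParametrizationData)
    (h3 : realPeriodRat_eq_unit_mul_plusPeriod_three)
    (h526 : MatarNekovar2019.prop526_hasIrreducibleModPGaloisRep_baseChange)
    (h526c : MatarNekovar2019.prop526_three_of_irreducible_of_not_isAbsolutelyIrreducible) :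
    AnalyticMuZeroOnClassX10b := by
  intro W _ _ p _ N _ f hX hns hf
  obtain ⟨hp3, hgo, hirr, -⟩ := id hX
  subst hp3
  obtain ⟨hgood, hord⟩ := hgo
  -- the level of `f` is the conductor
  obtain rfl : N = W.conductorNorm ℤ := IsNewformOf.level_eq_conductorNorm_of_exists_isNewformOf hmod hf
  -- the normalised cyclotomic datum, the period unit `ϖ` and X_A3 at the pair
  obtain ⟨κ, hκ, γ, hγ, hγ'⟩ := exists_isCyclotomic_isTopGenerator_isCyclotomicVariable_holds 3
  obtain ⟨u, hu1, huΩ⟩ := h3 W hgood hirr f hf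
  have hu0 : (u : ℝ) ≠ 0 := by
    have : (u : ℚ_[3]) ≠ 0 := fun h0 => by rw [h0, norm_zero] at hu1; exact zero_ne_one hu1
    exact_mod_cast (show u ≠ 0 from fun h0 => this (by rw [h0]; push_cast; rfl))
  have hϖ : ((u⁻¹ : ℚ) : ℝ) * W.realPeriodRat = plusPeriod f := by
    rw [huΩ, Rat.cast_inv, ← mul_assoc, inv_mul_cancel₀ hu0, one_mul]
  have hϖu : ‖((u⁻¹ : ℚ) : ℚ_[3])‖ = 1 := by rw [Rat.cast_inv, norm_inv, hu1, inv_one]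
  obtain ⟨htors, g, hchar, hιg⟩ :=
    mazurMainConjectureOnClassX10b_of_muZeroSmallImageThree hμ3 h42 h49 h53 h37 hmod hmodP h3 h526 h526c
      W 3 hX hns κ γ hκ hγ hγ' f hf u⁻¹ hϖ (W.selmerDualData κ hγ)
  haveI : Module.Finite (IwasawaAlgebra 3) (W.selmerDualData κ hγ).X :=
    (W.selmerDualData κ hγ).module_finite_holds hγ
  have hg : GreenbergVatsal2000.HasUnitContent g :=
    (GreenbergVatsal2000.mu_eq_zero_iff_hasUnitContent _ htors hchar).mp
      (hμ3 W hgood hord hirr hns κ γ hκ hγ hγ' _ htors)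
  rw [GreenbergVatsal2000.hasUnitContent_iff_exists_norm_coeff_map_eq_one, hιg] at hg
  obtain ⟨n, hn⟩ := hg
  refine ⟨n, ?_⟩
  rw [PowerSeries.coeff_C_mul, norm_mul, hϖu, one_mul] at hn
  exact hn

/-! ### §4 (μ3) ⟸ Greenberg's Conjecture 1.11 (irreducible form) -/

/-- **(μ3) is a special case of Greenberg's Conjecture 1.11 (irreducible form)** — `p = 3`, the
torsion guard kept: the typed leaf `GreenbergMuConjectureIrreducible` quantifies over every elliptic
`W/ℚ` and prime `p` with `E[p]` irreducible. So the sibling displays `…_of_greenbergMuConjectureIrreducible`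
are the composites of this with §3. [cite: GreenbergLNM1716, §1 Conj. 1.11] -/
theorem muZeroSmallImageThree_of_greenbergMuConjectureIrreducible
    (hGrμ : Summit.BirchSwinnertonDyer.Rank1Residual.GreenbergMuConjectureIrreducible) :
    ∀ (V : WeierstrassCurve ℚ) [V.IsElliptic] [V.IsGloballyMinimal],
      V.HasGoodReductionAtPrime 3 → ¬ ((3 : ℕ) : ℤ) ∣ V.frobeniusTrace 3 →
      V.HasIrreducibleModPGaloisRep 3 → ¬ V.HasSurjectiveModNGaloisRep 3 →
      ∀ (κ : ZpExtension ℚ 3) (γ : Field.absoluteGaloisGroup ℚ),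
        κ.IsCyclotomic → κ.IsTopGenerator γ → IsCyclotomicVariable 3 γ →
        ∀ D : V.SelmerDualData κ γ, D.IsTorsion → D.mu = 0 :=
  fun V _ _ _ _ hirr _ κ γ hκ hγ _ D hD => hGrμ V 3 κ γ hκ hγ hirr D hD

/-- **X_A3 at EVERY globally minimal small-image pair at `3`, any analytic rank, from Greenberg's
Conjecture 1.11 (irreducible form) and named facts** — the composite of
`muZeroSmallImageThree_of_greenbergMuConjectureIrreducible` with
`mazurMainConjecture_three_of_muZeroSmallImageThree`: `MazurMainConjecture W 3` for `W` good ordinary at `3`,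
`E[3]` irreducible, `ρ̄_{W,3}` not surjective — no `ClassX10` rank clause (the sibling's class display
`mazurMainConjectureOnClassX10b_of_greenbergMuConjectureIrreducible` is its restriction to X10b pairs).
CONDITIONAL (Greenberg OPEN); nothing booked.
[cite: GreenbergLNM1716, §1 Conj. 1.11] [cite: YanZhu2024MainConjNonCM, Thm. 4.9 (v2) = Thm. 5.2 (v4)] -/
theorem mazurMainConjecture_three_of_greenbergMuConjectureIrreducible
    (hGrμ : Summit.BirchSwinnertonDyer.Rank1Residual.GreenbergMuConjectureIrreducible)
    (h42 : thm42_XOrd₂_isTorsion_charIdeal_le_perrinRiou)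
    (h49 : thm49_charIdeal_eq_padicLFunction)
    (h53 : lemma53_charIdeal_mul_charIdeal_le_toPlus_charIdeal)
    (h37 : prop37_cycRestrict_perrinRiou_eq_padicLFunction_mul)
    (hmod : exists_isNewformOf) (hmodP : nonempty_modularParametrizationData)
    (h3 : realPeriodRat_eq_unit_mul_plusPeriod_three)
    (h526 : MatarNekovar2019.prop526_hasIrreducibleModPGaloisRep_baseChange)
    (h526c : MatarNekovar2019.prop526_three_of_irreducible_of_not_isAbsolutelyIrreducible)
    (W : WeierstrassCurve ℚ) [W.IsElliptic] [W.IsGloballyMinimal] [Fact (Nat.Prime 3)]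
    (hgood : W.HasGoodReductionAtPrime 3) (hord : ¬ ((3 : ℕ) : ℤ) ∣ W.frobeniusTrace 3)
    (hirr : W.HasIrreducibleModPGaloisRep 3) (hns : ¬ W.HasSurjectiveModNGaloisRep 3) :
    MazurMainConjecture W 3 :=
  mazurMainConjecture_three_of_muZeroSmallImageThree
    (muZeroSmallImageThree_of_greenbergMuConjectureIrreducible hGrμ) h42 h49 h53 h37 hmod hmodP h3 h526
    h526c W hgood hord hirr hns

end Summit.BirchSwinnertonDyer.Rank1Residual.X10

end
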